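import Mathlib
import Literature.Probability.LatticeModels.AnchoredClusterExpansion
import Literature.Probability.LatticeModels.TriangularLatticeProofs
import Literature.Probability.RandomPlanarGeometry.HexSAWLattice
import Literature.Probability.RandomPlanarGeometry.SAWDegreeGrowth
import Summits.CriticalPhenomena.SAWScalingLimit.Theorems.SAWMassiveIsingTiltCriticalCurveContinuityIsSmallActivityLoopActivity

/-!
# An explicit Kotecký–Preiss radius for the cycle activities of the honeycomb loop gas

Route `SAWMassiveIsingTilt` of `CriticalPhenomena/SAWScalingLimit`; line `registered` of the crux
`CriticalCurveContinuity` (stmt-CriticalPhenomena-7686), cycle 4, sub-goal S2. The loop gas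
`Σ_{even E ⊆ E(H)} z^{|E|}` on a subgraph `H` of the honeycomb lattice is the subset-polymer gas
of the vertex supports `A` of connected even nonempty edge sets `E ⊆ E(H)`, with activity
`ρ(A) = Σ_{E : supp E = A} z^{|E|}`; `isSmallActivity_loopActivity` gives its Kotecký–Preiss
smallness for `‖z‖ ≤ y₀` with an existence-grade `y₀`. Here the radius is explicit:
`IsSmallActivity ρ (1/2)` for `‖z‖ ≤ 1/13`, uniformly in `H`.

* Every honeycomb vertex has three neighbours, so an even edge set has all degrees in `{0, 2}`;
  following "the other edge" from a site `x` of a connected even `E` traces a self-avoiding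
  lattice walk with `|E|` vertices from `x` closing up into `E` (`kpRadius_cycle`).
* Hence at most `c_{m-1} ≤ 3 · 2^{m-2}` connected even sets of `m ≥ 3` edges pass through `x`
  (`kpRadius_card_le`, via `sawCount_succ_le`), and with `q = ‖z‖ e^{3/2} ≤ 9/26`
  (`e^{3/2} < 9/2`) the anchored sum is `≤ Σ_{m ≥ 3} (3/4) (2q)^m ≤ (3/4)(2q)^3/(1-2q) < 1`.
-/

noncomputable section

open Finset
open Literature.Probability Literature.Probability.LatticeModels
  Literature.Probability.RandomPlanarGeometry
open scoped Classical

namespace Summit.CriticalPhenomena.SAWScalingLimit.Theorems.SAWMassiveIsingTilt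

/-- On the honeycomb lattice (degree `3`) an even set of lattice edges has at most two edges at
each vertex. -/
theorem kpRadius_card_filter_le_two {E : Finset (Sym2 HexVertex)}
    (hE : ∀ e ∈ E, e ∈ hexGraph.edgeSet) (heven : ∀ u, Even (E.filter (u ∈ ·)).card)
    (u : HexVertex) : (E.filter (fun e => u ∈ e)).card ≤ 2 := by
  obtain ⟨N, hN3, hN⟩ := loopAct_exists_nbr
  have h3 : (E.filter (fun e => u ∈ e)).card ≤ 3 := by
    refine (Finset.card_le_card (t := (N u).image fun w => s(u, w)) fun e he => ?_).trans
      (Finset.card_image_le.trans (hN3 u))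
    obtain ⟨he, hu⟩ := Finset.mem_filter.1 he
    obtain ⟨w, rfl⟩ := Sym2.mem_iff_exists.1 hu
    exact Finset.mem_image.2 ⟨w, hN u w (hE _ he), rfl⟩
  obtain ⟨r, hr⟩ := heven u
  omega

/-- A vertex of an even set of lattice edges has at most two neighbours along it. -/
theorem kpRadius_eq_or_eq {E : Finset (Sym2 HexVertex)} (hE : ∀ e ∈ E, e ∈ hexGraph.edgeSet)
    (heven : ∀ u : HexVertex, Even (E.filter (fun e => u ∈ e)).card) {u a b c : HexVertex}
    (ha : s(u, a) ∈ E) (hb : s(u, b) ∈ E) (hc : s(u, c) ∈ E) (hab : a ≠ b) :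
    c = a ∨ c = b := by
  by_contra! h
  have hsub : ({s(u, a), s(u, b), s(u, c)} : Finset (Sym2 HexVertex)) ⊆
      E.filter (fun e => u ∈ e) := by
    simp only [Finset.insert_subset_iff, Finset.singleton_subset_iff, Finset.mem_filter]
    exact ⟨⟨ha, Sym2.mem_mk_left _ _⟩, ⟨hb, Sym2.mem_mk_left _ _⟩,
      ⟨hc, Sym2.mem_mk_left _ _⟩⟩
  have hcard : ({s(u, a), s(u, b), s(u, c)} : Finset (Sym2 HexVertex)).card = 3 := by
    rw [Finset.card_insert_of_notMem,
      Finset.card_pair fun h' => h.2 (Sym2.congr_right.1 h').symm]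
    simp only [Finset.mem_insert, Finset.mem_singleton, Sym2.congr_right]
    push Not
    exact ⟨hab, fun h' => h.1 h'.symm⟩
  have := (Finset.card_le_card hsub).trans (kpRadius_card_filter_le_two hE heven u)
  omega

/-- Each edge of an even set of lattice edges is continued by another edge at each endpoint. -/
theorem kpRadius_exists_ne {E : Finset (Sym2 HexVertex)}
    (heven : ∀ u : HexVertex, Even (E.filter (fun e => u ∈ e)).card) {u a : HexVertex}
    (ha : s(u, a) ∈ E) : ∃ b, b ≠ a ∧ s(u, b) ∈ E := by
  have h1 : 1 < (E.filter (fun e => u ∈ e)).card := by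
    have hpos : 0 < (E.filter (fun e => u ∈ e)).card :=
      Finset.card_pos.2 ⟨_, Finset.mem_filter.2 ⟨ha, Sym2.mem_mk_left _ _⟩⟩
    obtain ⟨r, hr⟩ := heven u
    omega
  obtain ⟨e, he, hne⟩ := Finset.exists_mem_ne h1 (s(u, a))
  obtain ⟨he, hu⟩ := Finset.mem_filter.1 he
  obtain ⟨b, rfl⟩ := Sym2.mem_iff_exists.1 hu
  exact ⟨b, fun h => hne (by rw [h]), he⟩

/-- **Following the other edge.** From an edge `x → y` of an even set of lattice edges there
is a walk `v` along `E` with `v 0 = x` (and `v 1 = y`) that never backtracks. -/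
theorem kpRadius_exists_walk {E : Finset (Sym2 HexVertex)}
    (heven : ∀ u : HexVertex, Even (E.filter (fun e => u ∈ e)).card) {x y : HexVertex}
    (hxy : s(x, y) ∈ E) :
    ∃ v : ℕ → HexVertex, v 0 = x ∧ ∀ k, s(v k, v (k + 1)) ∈ E ∧ v (k + 2) ≠ v k := by
  have H : ∀ a b : HexVertex, s(b, a) ∈ E → ∃ c, c ≠ a ∧ s(b, c) ∈ E :=
    fun a b h => kpRadius_exists_ne heven h
  choose! next hne hmem using H
  -- the pairs (current vertex, next vertex)
  let w : ℕ → HexVertex × HexVertex := fun k =>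
    Nat.rec (motive := fun _ => HexVertex × HexVertex) (x, y)
      (fun _ p => (p.2, next p.1 p.2)) k
  have hw : ∀ k, s((w k).2, (w k).1) ∈ E := by
    intro k
    induction k with
    | zero => rw [Sym2.eq_swap]; exact hxy
    | succ k ih => rw [Sym2.eq_swap]; exact hmem _ _ ih
  refine ⟨fun k => (w k).1, rfl, fun k => ⟨?_, ?_⟩⟩
  · have h := hw k
    rw [Sym2.eq_swap] at h
    exact h
  · exact hne _ _ (hw k)

/-- **Connected even sets of honeycomb edges are cycles.** If `E` is a set of lattice edges with
all degrees even which is connected on its support, and the site `x` lies on `E`, then `E` has at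
least three edges, its support has at most `|E|` vertices, and `E` is traced by a self-avoiding
lattice walk with `|E|` vertices from `x`, closed up at `x`. -/
theorem kpRadius_cycle {E : Finset (Sym2 HexVertex)} (hE : ∀ e ∈ E, e ∈ hexGraph.edgeSet)
    (heven : ∀ u : HexVertex, Even (E.filter (fun e => u ∈ e)).card)
    (hconn : ∀ u ∈ E.biUnion Sym2.toFinset, ∀ w ∈ E.biUnion Sym2.toFinset,
      (SimpleGraph.fromEdgeSet (E : Set (Sym2 HexVertex))).Reachable u w)
    {x : HexVertex} (hx : x ∈ E.biUnion Sym2.toFinset) :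
    3 ≤ E.card ∧ (E.biUnion Sym2.toFinset).card ≤ E.card ∧
      ∃ l ∈ SAW.sawLists hexGraph x (E.card - 1),
        (Finset.range l.length).image (fun k => s(l.getD k x, l.getD (k + 1) x)) = E := by
  -- the first step `x → y` and the walk `v` following the other edge
  obtain ⟨e₀, he₀, hxe₀⟩ := Finset.mem_biUnion.1 hx
  obtain ⟨y, rfl⟩ := Sym2.mem_iff_exists.1 (Sym2.mem_toFinset.1 hxe₀)
  obtain ⟨v, hv0, hv⟩ := kpRadius_exists_walk heven he₀
  have hmem : ∀ k, s(v k, v (k + 1)) ∈ E := fun k => (hv k).1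
  have hback : ∀ k, v (k + 2) ≠ v k := fun k => (hv k).2
  have hne : ∀ k, v k ≠ v (k + 1) := fun k =>
    SimpleGraph.Adj.ne (show hexGraph.Adj (v k) (v (k + 1)) from hE _ (hmem k))
  have hvA : ∀ k, v k ∈ E.biUnion Sym2.toFinset := fun k =>
    Finset.mem_biUnion.2 ⟨_, hmem k, Sym2.mem_toFinset.2 (Sym2.mem_mk_left _ _)⟩
  -- the first repetition of the walk
  have hP : ∃ n, ∃ i < n, v i = v n := by
    obtain ⟨i, -, j, -, hij, h⟩ := Finset.exists_ne_map_eq_of_card_lt_of_maps_to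
      (s := Finset.range ((E.biUnion Sym2.toFinset).card + 1)) (t := E.biUnion Sym2.toFinset)
      (by simp) (f := v) fun k _ => hvA k
    rcases lt_or_gt_of_ne hij with h' | h'
    exacts [⟨j, i, h', h⟩, ⟨i, j, h', h.symm⟩]
  obtain ⟨n, ⟨i, hin, hi⟩, hmin⟩ :
      ∃ n, (∃ i < n, v i = v n) ∧ ∀ m < n, ¬ ∃ i < m, v i = v m :=
    ⟨Nat.find hP, Nat.find_spec hP, fun m hm => Nat.find_min hP hm⟩
  obtain ⟨m, rfl⟩ : ∃ m, n = m + 1 := ⟨n - 1, by omega⟩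
  have hinj : ∀ a b, a < m + 1 → b < m + 1 → v a = v b → a = b := by
    intro a b ha hb h; by_contra hab
    rcases lt_or_gt_of_ne hab with h' | h'
    exacts [hmin b hb ⟨a, h', h⟩, hmin a ha ⟨b, h', h.symm⟩]
  -- it is a return to `x`: an earlier vertex `v i`, `0 < i`, already has its two edges
  obtain rfl : i = 0 := by
    by_contra hi0
    obtain ⟨i, rfl⟩ : ∃ j, i = j + 1 := ⟨i - 1, by omega⟩
    have hn2 : m + 1 ≠ i + 2 := fun h => hne (i + 1) (by rw [h] at hi; exact hi)
    have hn3 : m + 1 ≠ i + 3 := fun h => hback (i + 1) (by rw [← h]; exact hi.symm)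
    have h3 : s(v (i + 1), v m) ∈ E := by
      have := hmem m; rwa [← hi, Sym2.eq_swap] at this
    rcases kpRadius_eq_or_eq hE heven (by rw [Sym2.eq_swap]; exact hmem i) (hmem (i + 1)) h3
      (hback i).symm with h | h
    · exact hmin m (by omega) ⟨i, by omega, h.symm⟩
    · exact hmin m (by omega) ⟨i + 2, by omega, h.symm⟩
  have hvn : v (m + 1) = x := hi.symm.trans hv0
  have hm0 : m ≠ 0 := by rintro rfl; exact hne 0 (hv0.trans hvn.symm)
  have hm1 : m ≠ 1 := by rintro rfl; exact hback 0 (hvn.trans hv0.symm)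
  -- every edge of `E` at a vertex of the walk is a step of the walk (or the closing edge)
  have hcl : ∀ k < m + 1, ∀ b, s(v k, b) ∈ E →
      ∃ k' < m + 1, s(v k', v (k' + 1)) = s(v k, b) := by
    intro k hk b hb
    rcases Nat.eq_zero_or_pos k with rfl | hk0
    · have h1 : s(v 0, v m) ∈ E := by
        have := hmem m; rwa [hvn, Sym2.eq_swap, ← hv0] at this
      rcases kpRadius_eq_or_eq hE heven (hmem 0) h1 hb (hmin m (by omega) ⟨1, by omega, ·⟩)
        with rfl | rfl
      · exact ⟨0, by omega, rfl⟩
      · exact ⟨m, by omega, by rw [hvn, ← hv0, Sym2.eq_swap]⟩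
    · obtain ⟨k, rfl⟩ : ∃ j, k = j + 1 := ⟨k - 1, by omega⟩
      have h1 : s(v (k + 1), v k) ∈ E := by rw [Sym2.eq_swap]; exact hmem k
      rcases kpRadius_eq_or_eq hE heven h1 (hmem (k + 1)) hb (hback k).symm with rfl | rfl
      · exact ⟨k, by omega, Sym2.eq_swap⟩
      · exact ⟨k + 1, hk, rfl⟩
  -- so the walk exhausts the support (connectedness) ...
  have hC : ∀ u ∈ E.biUnion Sym2.toFinset, ∃ k < m + 1, v k = u := by
    intro u hu
    have h := (SimpleGraph.reachable_iff_reflTransGen _ _).1 (hconn x hx u hu)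
    clear hu
    induction h with
    | refl => exact ⟨0, by omega, hv0⟩
    | @tail b c _ hab ih =>
      obtain ⟨k, hk, rfl⟩ := ih
      rw [SimpleGraph.fromEdgeSet_adj, Finset.mem_coe] at hab
      obtain ⟨k', hk', h'⟩ := hcl k hk c hab.1
      have hb : c ∈ s(v k', v (k' + 1)) := by rw [h']; exact Sym2.mem_mk_right _ _
      rcases Sym2.mem_iff.1 hb with h | h <;> rw [h]
      · exact ⟨k', hk', rfl⟩
      · rcases Nat.lt_or_ge (k' + 1) (m + 1) with h'' | h''
        · exact ⟨k' + 1, h'', rfl⟩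
        · exact ⟨0, by omega, by rw [show k' + 1 = m + 1 by omega, hvn, hv0]⟩
  have hAn : (E.biUnion Sym2.toFinset).card ≤ m + 1 := by
    refine (Finset.card_le_card (t := (Finset.range (m + 1)).image v) fun u hu => ?_).trans
      (Finset.card_image_le.trans (Finset.card_range _).le)
    obtain ⟨k, hk, rfl⟩ := hC u hu
    exact Finset.mem_image_of_mem _ (Finset.mem_range.2 hk)
  -- ... and `E` is exactly the set of its `m + 1` (distinct) steps
  set S : Finset (Sym2 HexVertex) := (Finset.range (m + 1)).image fun k => s(v k, v (k + 1)) with hS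
  have hES : E = S := by
    refine Finset.Subset.antisymm (fun e he => ?_) fun e he => ?_
    · induction e with | h a b => ?_
      obtain ⟨k, hk, rfl⟩ := hC a
        (Finset.mem_biUnion.2 ⟨_, he, Sym2.mem_toFinset.2 (Sym2.mem_mk_left _ _)⟩)
      obtain ⟨k', hk', h'⟩ := hcl k hk b he
      exact Finset.mem_image.2 ⟨k', Finset.mem_range.2 hk', h'⟩
    · obtain ⟨k, -, rfl⟩ := Finset.mem_image.1 he
      exact hmem k
  have hSn : S.card = m + 1 := by
    rw [hS, Finset.card_image_of_injOn, Finset.card_range]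
    intro a ha b hb h
    rw [Finset.coe_range, Set.mem_Iio] at ha hb
    rcases Sym2.eq_iff.1 h with ⟨h1, -⟩ | ⟨h1, h2⟩
    · exact hinj a b ha hb h1
    · exfalso
      rcases Nat.lt_or_ge (b + 1) (m + 1) with hb1 | hb1
      · obtain rfl := hinj a (b + 1) ha hb1 h1
        exact hback b h2
      · obtain rfl : b = m := by omega
        obtain rfl := hinj a 0 ha (by omega) (by rw [h1, hvn, hv0])
        have := hinj (0 + 1) b (by omega) hb h2
        omega
  have hEn : E.card = m + 1 := by rw [hES, hSn]
  refine ⟨by omega, by omega, (List.range (m + 1)).map v, ?_, ?_⟩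
  · rw [hEn, Nat.add_sub_cancel, SAW.mem_sawLists_iff]
    refine ⟨?_, by simp [List.range_succ_eq_map, hv0], by simp, List.nodup_range.map_on
      fun a ha b hb h => hinj a b (List.mem_range.1 ha) (List.mem_range.1 hb) h⟩
    rw [List.isChain_map, List.isChain_range_succ]
    exact fun k _ => hE _ (hmem k)
  · have hget : ∀ j ≤ m + 1, ((List.range (m + 1)).map v).getD j x = v j := by
      intro j hj
      rcases hj.lt_or_eq with h | rfl
      · simp [List.getD_eq_getElem?_getD, List.getElem?_range h]
      · simp [List.getD_eq_getElem?_getD, hvn]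
    rw [hES, List.length_map, List.length_range]
    exact Finset.image_congr fun k hk => by
      have hk : k < m + 1 := Finset.mem_range.1 hk
      rw [hget k hk.le, hget (k + 1) hk]

/-- **At most `3 · 2^{m-2}` connected even sets of `m` lattice edges pass through a site**: each
is traced by one of the `c_{m-1} ≤ 3 · 2^{m-2}` self-avoiding walks with `m` vertices from it. -/
theorem kpRadius_card_le {x : HexVertex} {m : ℕ} (𝓔 : Finset (Finset (Sym2 HexVertex)))
    (h𝓔 : ∀ E ∈ 𝓔, (∀ e ∈ E, e ∈ hexGraph.edgeSet) ∧
      (∀ u : HexVertex, Even (E.filter (fun e => u ∈ e)).card) ∧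
      (∀ u ∈ E.biUnion Sym2.toFinset, ∀ w ∈ E.biUnion Sym2.toFinset,
        (SimpleGraph.fromEdgeSet (E : Set (Sym2 HexVertex))).Reachable u w) ∧
      x ∈ E.biUnion Sym2.toFinset ∧ E.card = m) :
    𝓔.card ≤ 3 * 2 ^ (m - 2) := by
  rcases 𝓔.eq_empty_or_nonempty with rfl | ⟨E₀, hE₀⟩
  · simp
  obtain ⟨hE, heven, hconn, hx, hEm⟩ := h𝓔 E₀ hE₀
  have h3 : 3 ≤ m := hEm ▸ (kpRadius_cycle hE heven hconn hx).1
  have hdeg : ∀ w, (hexGraph.neighborSet w).encard ≤ ((2 : ℕ) : ℕ∞) + 1 := fun w => by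
    have hfin : (hexGraph.neighborSet w).Finite :=
      Set.finite_of_ncard_ne_zero (by rw [card_neighborSet_hexGraph_holds w]; norm_num)
    rw [← hfin.cast_ncard_eq, card_neighborSet_hexGraph_holds w]
    norm_num
  have hfin : (SAW.sawLists hexGraph x (m - 1)).Finite := SAW.finite_sawLists hdeg x (m - 1)
  calc 𝓔.card ≤ (hfin.toFinset.image fun l : List HexVertex =>
        (Finset.range l.length).image fun k => s(l.getD k x, l.getD (k + 1) x)).card := by
        refine Finset.card_le_card fun E hE' => ?_
        obtain ⟨hE, heven, hconn, hx, hEm⟩ := h𝓔 E hE'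
        obtain ⟨-, -, l, hl, hlE⟩ := kpRadius_cycle hE heven hconn hx
        exact Finset.mem_image.2 ⟨l, hfin.mem_toFinset.2 (hEm ▸ hl), hlE⟩
    _ ≤ hfin.toFinset.card := Finset.card_image_le
    _ = (SAW.sawLists hexGraph x (m - 1)).ncard := (Set.ncard_eq_toFinset_card _ hfin).symm
    _ = SAW.sawCount hexGraph x (m - 2 + 1) := by
        rw [SAW.sawCount_eq_ncard_sawLists, show m - 2 + 1 = m - 1 by omega]
    _ ≤ (2 + 1) * 2 ^ (m - 2) := SAW.sawCount_succ_le hdeg x (m - 2)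
    _ = 3 * 2 ^ (m - 2) := by norm_num

/-- **S2: explicit Kotecký–Preiss radius `1/13` for the cycle activities of the honeycomb loop
gas.** For `‖z‖ ≤ 1/13` the activities
`ρ(A) = Σ_{E ⊆ E(H) : supp E = A, E even connected nonempty} z^{|E|}` of the loop gas on any
subgraph `H` of the honeycomb lattice satisfy `IsSmallActivity ρ (1/2)`: a polymer through `x`
with `m` edges is one of `≤ 3 · 2^{m-2}` cycles with `m ≥ 3` sites, and
`Σ_{m ≥ 3} 3 · 2^{m-2} (‖z‖ e^{3/2})^m ≤ (3/4) (9/13)^3 / (4/13) < 1`. -/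
theorem isSmallActivity_loopActivity_of_norm_le : ∀ (EH : Finset (Sym2 HexVertex)),
    (∀ e ∈ EH, e ∈ hexGraph.edgeSet) → ∀ z : ℂ, ‖z‖ ≤ 1 / 13 →
      IsSmallActivity (fun A : Finset HexVertex => ∑ E ∈ EH.powerset with
        (E.biUnion Sym2.toFinset = A ∧ A.Nonempty ∧
          (∀ u : HexVertex, Even (E.filter (fun e => u ∈ e)).card) ∧
          ∀ u ∈ A, ∀ w ∈ A, (SimpleGraph.fromEdgeSet
            ((E : Finset (Sym2 HexVertex)) : Set (Sym2 HexVertex))).Reachable u w),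
        z ^ E.card) (1 / 2) := by
  intro EH hEH z hz
  refine ⟨?_, one_half_pos, fun x 𝒜 h𝒜 => ?_⟩
  · exact sum_eq_zero fun E hE => absurd (mem_filter.1 hE).2.2.1 not_nonempty_empty
  -- the smallness parameter `q = ‖z‖ e^{3/2}`, `2q ≤ 9/13`
  have he : Real.exp (3 / 2) < 9 / 2 := by
    have h3 : Real.exp (3 / 2) ^ 2 < (9 / 2) ^ 2 := by
      calc Real.exp (3 / 2) ^ 2 = Real.exp 1 ^ 3 := by
            rw [← Real.exp_nat_mul, ← Real.exp_nat_mul]; norm_num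
        _ < 2.7182818286 ^ 3 :=
            pow_lt_pow_left₀ Real.exp_one_lt_d9 (Real.exp_pos 1).le (by norm_num)
        _ < (9 / 2) ^ 2 := by norm_num
    exact lt_of_pow_lt_pow_left₀ 2 (by norm_num) h3
  set q : ℝ := ‖z‖ * Real.exp (3 / 2) with hq
  have hq0 : 0 ≤ q := by positivity
  have hq2 : 2 * q ≤ 9 / 13 := by
    linarith [(mul_le_mul hz he.le (Real.exp_pos _).le (by norm_num) : q ≤ 1 / 13 * (9 / 2))]
  -- the fibres `F A` of `ρ` and the connected even edge sets `𝓔` through `x`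
  set F : Finset HexVertex → Finset (Finset (Sym2 HexVertex)) := fun A =>
    EH.powerset.filter fun E => E.biUnion Sym2.toFinset = A ∧ A.Nonempty ∧
      (∀ u : HexVertex, Even (E.filter (fun e => u ∈ e)).card) ∧
      ∀ u ∈ A, ∀ w ∈ A, (SimpleGraph.fromEdgeSet (E : Set (Sym2 HexVertex))).Reachable u w
    with hF
  set 𝓔 : Finset (Finset (Sym2 HexVertex)) := EH.powerset.filter fun E =>
    (∀ u : HexVertex, Even (E.filter (fun e => u ∈ e)).card) ∧
      (∀ u ∈ E.biUnion Sym2.toFinset, ∀ w ∈ E.biUnion Sym2.toFinset,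
        (SimpleGraph.fromEdgeSet (E : Set (Sym2 HexVertex))).Reachable u w) ∧
      x ∈ E.biUnion Sym2.toFinset with h𝓔
  have key : ∀ A ∈ 𝒜, ‖∑ E ∈ F A, z ^ E.card‖ * Real.exp ((1 + 1 / 2) * A.card) ≤
      ∑ E ∈ F A, q ^ E.card := by
    intro A hA
    calc ‖∑ E ∈ F A, z ^ E.card‖ * Real.exp ((1 + 1 / 2) * A.card)
        ≤ (∑ E ∈ F A, ‖z‖ ^ E.card) * Real.exp ((1 + 1 / 2) * A.card) := by
          gcongr
          exact (norm_sum_le _ _).trans_eq (Finset.sum_congr rfl fun E _ => norm_pow z _)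
      _ = ∑ E ∈ F A, ‖z‖ ^ E.card * Real.exp ((1 + 1 / 2) * A.card) := Finset.sum_mul _ _ _
      _ ≤ ∑ E ∈ F A, q ^ E.card := Finset.sum_le_sum fun E hE => ?_
    obtain ⟨hEEH, hEA, -, heven, hconn⟩ := Finset.mem_filter.1 hE
    subst hEA
    have hAE := (kpRadius_cycle (fun e he => hEH e (mem_powerset.1 hEEH he)) heven hconn
      (h𝒜 _ hA)).2.1
    calc ‖z‖ ^ E.card * Real.exp ((1 + 1 / 2) * ((E.biUnion Sym2.toFinset).card : ℝ))
        ≤ ‖z‖ ^ E.card * Real.exp ((1 + 1 / 2) * (E.card : ℝ)) := by gcongr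
      _ = q ^ E.card := by
          rw [hq, mul_pow, ← Real.exp_nat_mul]
          congr 2
          ring
  have hdisj : (𝒜 : Set (Finset HexVertex)).PairwiseDisjoint F := fun A _ B _ hAB =>
    Finset.disjoint_left.2 fun E hEA hEB =>
      hAB ((Finset.mem_filter.1 hEA).2.1.symm.trans (Finset.mem_filter.1 hEB).2.1)
  have hsub : 𝒜.biUnion F ⊆ 𝓔 := by
    intro E hE
    obtain ⟨A, hA, hEA⟩ := Finset.mem_biUnion.1 hE
    obtain ⟨hEEH, hEA, -, heven, hconn⟩ := Finset.mem_filter.1 hEA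
    subst hEA
    exact Finset.mem_filter.2 ⟨hEEH, heven, hconn, h𝒜 _ hA⟩
  have hcount : ∀ m ∈ 𝓔.image Finset.card,
      3 ≤ m ∧ (#(𝓔.filter fun E => E.card = m) : ℝ) * q ^ m ≤ 3 / 4 * (2 * q) ^ m := by
    intro m hm
    obtain ⟨E, hE, rfl⟩ := Finset.mem_image.1 hm
    obtain ⟨hEEH, heven, hconn, hxE⟩ := Finset.mem_filter.1 hE
    have h3 := (kpRadius_cycle (fun e he => hEH e (mem_powerset.1 hEEH he)) heven hconn hxE).1
    refine ⟨h3, ?_⟩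
    have hcard := kpRadius_card_le (x := x) (m := E.card) (𝓔.filter fun E' => E'.card = E.card)
      fun E' hE' => by
        obtain ⟨hE'𝓔, hcE'⟩ := Finset.mem_filter.1 hE'
        obtain ⟨hEEH', heven', hconn', hxE'⟩ := Finset.mem_filter.1 hE'𝓔
        exact ⟨fun e he => hEH e (Finset.mem_powerset.1 hEEH' he), heven', hconn', hxE', hcE'⟩
    obtain ⟨k, hk⟩ : ∃ k, E.card = k + 2 := ⟨E.card - 2, by omega⟩
    rw [hk, Nat.add_sub_cancel] at hcard; rw [hk]
    calc ((𝓔.filter fun E' => E'.card = k + 2).card : ℝ) * q ^ (k + 2)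
        ≤ (3 * 2 ^ k : ℝ) * q ^ (k + 2) := by gcongr; exact_mod_cast hcard
      _ = 3 / 4 * (2 * q) ^ (k + 2) := by ring
  obtain ⟨M, hM⟩ := (𝓔.image Finset.card).exists_nat_subset_range
  calc ∑ A ∈ 𝒜, ‖∑ E ∈ F A, z ^ E.card‖ * Real.exp ((1 + 1 / 2) * (A.card : ℝ))
      ≤ ∑ A ∈ 𝒜, ∑ E ∈ F A, q ^ E.card := Finset.sum_le_sum key
    _ = ∑ E ∈ 𝒜.biUnion F, q ^ E.card := (Finset.sum_biUnion hdisj).symm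
    _ ≤ ∑ E ∈ 𝓔, q ^ E.card :=
        Finset.sum_le_sum_of_subset_of_nonneg hsub fun _ _ _ => by positivity
    _ = ∑ m ∈ 𝓔.image Finset.card, (#(𝓔.filter fun E => E.card = m) : ℝ) * q ^ m := by
        rw [Finset.sum_comp (fun k => q ^ k) Finset.card]
        simp only [nsmul_eq_mul]
    _ ≤ ∑ m ∈ 𝓔.image Finset.card, 3 / 4 * (2 * q) ^ m :=
        Finset.sum_le_sum fun m hm => (hcount m hm).2
    _ ≤ ∑ m ∈ Finset.Ico 3 M, 3 / 4 * (2 * q) ^ m :=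
        Finset.sum_le_sum_of_subset_of_nonneg
          (fun m hm => Finset.mem_Ico.2 ⟨(hcount m hm).1, Finset.mem_range.1 (hM hm)⟩)
          fun _ _ _ => by positivity
    _ = 3 / 4 * ∑ m ∈ Finset.Ico 3 M, (2 * q) ^ m := (Finset.mul_sum _ _ _).symm
    _ ≤ 3 / 4 * ((2 * q) ^ 3 / (1 - 2 * q)) := by
        gcongr
        exact geom_sum_Ico_le_of_lt_one (by positivity) (by linarith)
    _ ≤ 1 := by
        have ht2 : (2 * q) ^ 2 ≤ (9 / 13) ^ 2 := pow_le_pow_left₀ (by positivity) hq2 2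
        rw [← mul_div_assoc, div_le_one (by linarith)]
        nlinarith [mul_nonneg (by positivity : (0 : ℝ) ≤ 2 * q) (sub_nonneg.2 ht2)]

end Summit.CriticalPhenomena.SAWScalingLimit.Theorems.SAWMassiveIsingTilt

end
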